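import Mathlib
import Summits.Ventures.HodgeRepro2.T6N5LocalSignModelCMWitness
import Summits.Ventures.HodgeRepro2.T6N5FockSmooth

/-!
# T6N5SignModelCMDisplays — the real-place hypotheses of t6-p8's host-shaped statement of rows 183–184
(`exists_signModel_ofGlobal` / `exists_signModel_ofCM`, T6N5LocalSignModelGlobal / T6N5LocalSignModelCM) taken in
the CONJUGATE-ORTHOGONAL form and FROM THE DISPLAYS BY NAME — Tier 6, M2 sub-step N5 (t6-p7), proof lane

t6-p8's seam takes, per real place and side, `(RA (Sum.inr τ)).FockDict` — the ALL-WEIGHT archimedean Fock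
dictionary, the one interface residual of condition (b) at the real places (IR; stronger than any printed statement
about the (U(1),U(1)) correspondence of characters of `K¹`, T6N5FockCarrier §1).  The accepted chain of this lane
replaces it: `FockDictCO` (the even weights only — exactly the content of the correspondence in weight form) suffices
(`realCondB_ofReal_CO`, T6N5FockCarrier p411341), and `FockDictCO` is a THEOREM on the (U(1),U(1)) K-type carrier
from the two Konno–Konno displays and the EX identifications (`fockDictCO_of_displays`, T6N5FockMain p412347;
bundled as `RealPlaceBundle`, T6N5FockBundle p413410).  This file carries both seams to t6-p8's host-shaped
statement, for a successor statement `HCCMOfPublished₃` that routes rows 183–184 through `exists_signModel_ofCM`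
(t6-lead STATUS l. 12810 (3)):

* `PlaceFamily.signModel_realCondB_CO` / `solves_realCondB_of_eq_CO`, `exists_signModel_ofGlobal_CO`,
  `exists_signModel_ofCM_CO` — the same statements with `FockDict` weakened to `FockDictCO` (a RE-TYPING of the IR
  binder to its honest interface; content unchanged; decision (8) class);
* `PlaceFamily.signModel_realCondB_displays` / `solves_realCondB_of_eq_displays` — the place-family level forms of
  the display seam (t6-p8's OPTION A shape of rows 183–184, STATUS l. 12835: `hS5 : R5.S = F5.signModel …`);
* `exists_signModel_ofGlobal_displays`, `exists_signModel_ofCM_displays` — the real-place hypotheses as a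
  `RealPlaceBundle` over the places (data + declared EX facts) and the DISPLAY binders by name at the real places:
  `Hyp.BFGYYZ2025_Thm3_5_smooth … (fun _ => True)` (the statements of record v2), `Hyp.KonnoKonno2007_Thm5_4_i_lines`
  (PRINT PENDING W-11 — banded so wherever consumed) and `Hyp.KonnoKonno2007_Fact5_1_compact` — IR 0 at the real
  places;
* non-vacuity on ANY CM field: `cm_global_witness_CO`, `cm_global_witness_displays` (the §10.5(ii)(c)/(d) witnesses
  with t6-p8's toy family and this lane's toy real data / toy bundle), and at `ℚ(ζ₄)` `gaussian_cm_witness_displays`.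

Nothing of t6-p8's accepted files changes (imported by name); no new display; count-neutral as a file.
§8(d): uses an L-value-free non-vanishing device: NO.
-/

namespace Summit.Ventures.HodgeRepro2.T6.N5LocalSignModel.PlaceFamily

open Summit.Ventures.HodgeRepro2.T6.N5LocalDatum Summit.Ventures.HodgeRepro2.T6.N5Rich
  Summit.Ventures.HodgeRepro2.T6.Hyp Summit.Ventures.HodgeRepro2.T6.N5RealPlace
  Summit.Ventures.HodgeRepro2.T6.N5LocalSignModel

noncomputable section

variable {K : Type} [Field K] [NumberField K] {L : Type} [Field L] [NumberField L] [Algebra K L]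
  {ι : Type*} (F : PlaceFamily K L ι)

/-- `hre` IN THE CONJUGATE-ORTHOGONAL FORM: `signModel_realCondB` with `FockDict` weakened to `FockDictCO`
(`realCondB_ofReal_CO`). -/
theorem signModel_realCondB_CO (hF : F.Hyps) (RA RB : ι → RealData)
    (h35A : ∀ v, F.kind v = PlaceKind.re → BFGYYZ2025_Thm3_5 (RA v).toLocal)
    (h35B : ∀ v, F.kind v = PlaceKind.re → BFGYYZ2025_Thm3_5 (RB v).toLocal)
    (hFA : ∀ v, F.kind v = PlaceKind.re → (RA v).FockDictCO)
    (hFB : ∀ v, F.kind v = PlaceKind.re → (RB v).FockDictCO)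
    (hHA : ∀ v, F.kind v = PlaceKind.re → ∀ i, (RA v).HalfLine i)
    (hHB : ∀ v, F.kind v = PlaceKind.re → ∀ i, (RB v).HalfLine i) :
    (F.signModel hF RA RB).RealCondB :=
  realCondB_ofReal_CO F.kind F.D (F.ξ hF) RA RB h35A h35B hFA hFB hHA hHB

/-- `hsol ∧ hre` for any rich datum whose sign model is the place family's — `solves_realCondB_of_eq` with the
real-place dictionary in the conjugate-orthogonal form. -/
theorem solves_realCondB_of_eq_CO {G : Type*} [CommGroup G] (R : RichData ι G) (hF : F.Hyps)
    (RA RB : ι → RealData) (hS : R.S = F.signModel hF RA RB)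
    (h35A : ∀ v, F.kind v = PlaceKind.re → BFGYYZ2025_Thm3_5 (RA v).toLocal)
    (h35B : ∀ v, F.kind v = PlaceKind.re → BFGYYZ2025_Thm3_5 (RB v).toLocal)
    (hFA : ∀ v, F.kind v = PlaceKind.re → (RA v).FockDictCO)
    (hFB : ∀ v, F.kind v = PlaceKind.re → (RB v).FockDictCO)
    (hHA : ∀ v, F.kind v = PlaceKind.re → ∀ i, (RA v).HalfLine i)
    (hHB : ∀ v, F.kind v = PlaceKind.re → ∀ i, (RB v).HalfLine i) :
    R.S.Solves ∧ R.S.RealCondB := by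
  rw [hS]
  exact ⟨F.signModel_solves hF RA RB, F.signModel_realCondB_CO hF RA RB h35A h35B hFA hFB hHA hHB⟩

/-- `hre` FROM THE DISPLAYS BY NAME at the level of the place family: the real-place bundle over the places (data
+ declared EX facts) and, at every real place of both sides, the restricted Epsilon Dichotomy, KK07 Theorem
5.4(i) at lines (print pending W-11) and KK07 Fact 5.1 — the all-weight dictionary gone. -/
theorem signModel_realCondB_displays (hF : F.Hyps) (RP : N5Fock.RealPlaceBundle ι)
    (h35A : ∀ v, F.kind v = PlaceKind.re → BFGYYZ2025_Thm3_5_smooth (RP.RA v).toLocal (fun _ => True))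
    (h35B : ∀ v, F.kind v = PlaceKind.re → BFGYYZ2025_Thm3_5_smooth (RP.RB v).toLocal (fun _ => True))
    (h54A : ∀ v, F.kind v = PlaceKind.re → KonnoKonno2007_Thm5_4_i_lines (RP.CA v))
    (h54B : ∀ v, F.kind v = PlaceKind.re → KonnoKonno2007_Thm5_4_i_lines (RP.CB v))
    (h51A : ∀ v, F.kind v = PlaceKind.re → KonnoKonno2007_Fact5_1_compact (RP.CA v))
    (h51B : ∀ v, F.kind v = PlaceKind.re → KonnoKonno2007_Fact5_1_compact (RP.CB v)) :
    (F.signModel hF RP.RA RP.RB).RealCondB :=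
  F.signModel_realCondB_CO hF RP.RA RP.RB
    (fun v hv => N5Fock.thm3_5_of_smooth_true _ (h35A v hv))
    (fun v hv => N5Fock.thm3_5_of_smooth_true _ (h35B v hv))
    (fun v hv => RP.fockDictCO_A v (h54A v hv) (h51A v hv))
    (fun v hv => RP.fockDictCO_B v (h54B v hv) (h51B v hv))
    (fun v _ i => RP.hHA v i) (fun v _ i => RP.hHB v i)

/-- `hsol ∧ hre` for any rich datum whose sign model is the place family's on the bundle's real data, from the
displays by name (the ₃-shaped rows 183–184 of t6-p8's OPTION A with IR 0 at the real places). -/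
theorem solves_realCondB_of_eq_displays {G : Type*} [CommGroup G] (R : RichData ι G) (hF : F.Hyps)
    (RP : N5Fock.RealPlaceBundle ι) (hS : R.S = F.signModel hF RP.RA RP.RB)
    (h35A : ∀ v, F.kind v = PlaceKind.re → BFGYYZ2025_Thm3_5_smooth (RP.RA v).toLocal (fun _ => True))
    (h35B : ∀ v, F.kind v = PlaceKind.re → BFGYYZ2025_Thm3_5_smooth (RP.RB v).toLocal (fun _ => True))
    (h54A : ∀ v, F.kind v = PlaceKind.re → KonnoKonno2007_Thm5_4_i_lines (RP.CA v))
    (h54B : ∀ v, F.kind v = PlaceKind.re → KonnoKonno2007_Thm5_4_i_lines (RP.CB v))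
    (h51A : ∀ v, F.kind v = PlaceKind.re → KonnoKonno2007_Fact5_1_compact (RP.CA v))
    (h51B : ∀ v, F.kind v = PlaceKind.re → KonnoKonno2007_Fact5_1_compact (RP.CB v)) :
    R.S.Solves ∧ R.S.RealCondB := by
  rw [hS]
  exact ⟨F.signModel_solves hF RP.RA RP.RB,
    F.signModel_realCondB_displays hF RP h35A h35B h54A h54B h51A h51B⟩

end

end Summit.Ventures.HodgeRepro2.T6.N5LocalSignModel.PlaceFamily

namespace Summit.Ventures.HodgeRepro2.T6.N5LocalSignModelGlobal

open Summit.Ventures.HodgeRepro2 IsDedekindDomain HeightOneSpectrum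
  Summit.Ventures.HodgeRepro2.T6.N5LocalDatum Summit.Ventures.HodgeRepro2.T6.N5Rich
  Summit.Ventures.HodgeRepro2.T6.Hyp Summit.Ventures.HodgeRepro2.T6.N5RealPlace
  Summit.Ventures.HodgeRepro2.T6.N5LocalSignModel Summit.Ventures.HodgeRepro2.T6.N5Fock

noncomputable section

section Global

variable {K : Type} [Field K] [NumberField K] {L : Type} [Field L] [NumberField L] [Algebra K L]
  (hKL : Module.finrank K L = 2) (T : ThreeDataFamily K L)

/-- `exists_signModel_ofGlobal` with the real-place dictionary in the CONJUGATE-ORTHOGONAL form (a re-typing of the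
IR binders `hFA` / `hFB` to their honest interface; content unchanged). -/
theorem exists_signModel_ofGlobal_CO
    (hT : ∀ (v : HeightOneSpectrum (NumberField.RingOfIntegers K)) (h : IsNonSplit K L v),
      (localInputAt hKL T h).Hyps)
    (RA RB : GlobalIndex K → RealData)
    (h35A : ∀ τ : {τ : NumberField.InfinitePlace K // τ.IsReal}, BFGYYZ2025_Thm3_5 (RA (Sum.inr τ)).toLocal)
    (h35B : ∀ τ : {τ : NumberField.InfinitePlace K // τ.IsReal}, BFGYYZ2025_Thm3_5 (RB (Sum.inr τ)).toLocal)
    (hFA : ∀ τ : {τ : NumberField.InfinitePlace K // τ.IsReal}, (RA (Sum.inr τ)).FockDictCO)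
    (hFB : ∀ τ : {τ : NumberField.InfinitePlace K // τ.IsReal}, (RB (Sum.inr τ)).FockDictCO)
    (hHA : ∀ τ : {τ : NumberField.InfinitePlace K // τ.IsReal}, ∀ i, (RA (Sum.inr τ)).HalfLine i)
    (hHB : ∀ τ : {τ : NumberField.InfinitePlace K // τ.IsReal}, ∀ i, (RB (Sum.inr τ)).HalfLine i) :
    ∃ S : SignModel (GlobalIndex K), S.kind = kindOf K L ∧ S.D = (PlaceFamily.ofGlobal hKL T).D ∧
      S.Solves ∧ S.RealCondB := by
  have hF : (PlaceFamily.ofGlobal hKL T).Hyps := (PlaceFamily.ofGlobal_hyps_iff hKL T).mpr hT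
  have hre : ∀ x : GlobalIndex K, (PlaceFamily.ofGlobal hKL T).kind x = PlaceKind.re → ∃ τ, x = Sum.inr τ :=
    fun x hx => exists_eq_inr_of_kindOf_eq_re hx
  refine ⟨(PlaceFamily.ofGlobal hKL T).signModel hF RA RB, rfl, rfl,
    (PlaceFamily.ofGlobal hKL T).signModel_solves hF RA RB,
    (PlaceFamily.ofGlobal hKL T).signModel_realCondB_CO hF RA RB ?_ ?_ ?_ ?_ ?_ ?_⟩
  · intro x hx
    obtain ⟨τ, rfl⟩ := hre x hx
    exact h35A τ
  · intro x hx
    obtain ⟨τ, rfl⟩ := hre x hx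
    exact h35B τ
  · intro x hx
    obtain ⟨τ, rfl⟩ := hre x hx
    exact hFA τ
  · intro x hx
    obtain ⟨τ, rfl⟩ := hre x hx
    exact hFB τ
  · intro x hx
    obtain ⟨τ, rfl⟩ := hre x hx
    exact hHA τ
  · intro x hx
    obtain ⟨τ, rfl⟩ := hre x hx
    exact hHB τ

/-- `exists_signModel_ofGlobal` WITH THE REAL-PLACE HYPOTHESES FROM THE DISPLAYS BY NAME: the real-place data,
the (U(1),U(1)) K-type carriers and the EX facts tying them as a `RealPlaceBundle` over the places of `K` (only its
values at the real places are used), and at every real place of both sides the displays `Hyp.BFGYYZ2025_Thm3_5_smooth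
… (fun _ => True)` (the statements of record v2), `Hyp.KonnoKonno2007_Thm5_4_i_lines` (print pending W-11) and
`Hyp.KonnoKonno2007_Fact5_1_compact` — the all-weight dictionary is gone (IR 0 at the real places). -/
theorem exists_signModel_ofGlobal_displays
    (hT : ∀ (v : HeightOneSpectrum (NumberField.RingOfIntegers K)) (h : IsNonSplit K L v),
      (localInputAt hKL T h).Hyps)
    (RP : RealPlaceBundle (GlobalIndex K))
    (h35A : ∀ τ : {τ : NumberField.InfinitePlace K // τ.IsReal},
      BFGYYZ2025_Thm3_5_smooth (RP.RA (Sum.inr τ)).toLocal (fun _ => True))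
    (h35B : ∀ τ : {τ : NumberField.InfinitePlace K // τ.IsReal},
      BFGYYZ2025_Thm3_5_smooth (RP.RB (Sum.inr τ)).toLocal (fun _ => True))
    (h54A : ∀ τ : {τ : NumberField.InfinitePlace K // τ.IsReal}, KonnoKonno2007_Thm5_4_i_lines (RP.CA (Sum.inr τ)))
    (h54B : ∀ τ : {τ : NumberField.InfinitePlace K // τ.IsReal}, KonnoKonno2007_Thm5_4_i_lines (RP.CB (Sum.inr τ)))
    (h51A : ∀ τ : {τ : NumberField.InfinitePlace K // τ.IsReal}, KonnoKonno2007_Fact5_1_compact (RP.CA (Sum.inr τ)))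
    (h51B : ∀ τ : {τ : NumberField.InfinitePlace K // τ.IsReal}, KonnoKonno2007_Fact5_1_compact (RP.CB (Sum.inr τ))) :
    ∃ S : SignModel (GlobalIndex K), S.kind = kindOf K L ∧ S.D = (PlaceFamily.ofGlobal hKL T).D ∧
      S.Solves ∧ S.RealCondB :=
  exists_signModel_ofGlobal_CO hKL T hT RP.RA RP.RB
    (fun τ => thm3_5_of_smooth_true _ (h35A τ)) (fun τ => thm3_5_of_smooth_true _ (h35B τ))
    (fun τ => RP.fockDictCO_A (Sum.inr τ) (h54A τ) (h51A τ))
    (fun τ => RP.fockDictCO_B (Sum.inr τ) (h54B τ) (h51B τ))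
    (fun τ => RP.hHA (Sum.inr τ)) (fun τ => RP.hHB (Sum.inr τ))

end Global

end

end Summit.Ventures.HodgeRepro2.T6.N5LocalSignModelGlobal

namespace Summit.Ventures.HodgeRepro2.T6.N5LocalSignModelCM

open Summit.Ventures.HodgeRepro2 IsDedekindDomain HeightOneSpectrum NumberField
  Summit.Ventures.HodgeRepro2.T6.N5LocalDatum Summit.Ventures.HodgeRepro2.T6.N5Rich
  Summit.Ventures.HodgeRepro2.T6.Hyp Summit.Ventures.HodgeRepro2.T6.N5RealPlace
  Summit.Ventures.HodgeRepro2.T6.N5LocalSignModel Summit.Ventures.HodgeRepro2.T6.N5LocalSignModelGlobal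
  Summit.Ventures.HodgeRepro2.T6.N5Fock

noncomputable section

section CM

variable (E : Type) [Field E] [NumberField E] [IsCMField E]

/-- `exists_signModel_ofCM` with the real-place dictionary in the CONJUGATE-ORTHOGONAL form (re-typing of `hFA` /
`hFB`; content unchanged). -/
theorem exists_signModel_ofCM_CO (T : ThreeDataFamily (maximalRealSubfield E) E)
    (hT : ∀ (v : HeightOneSpectrum (RingOfIntegers (maximalRealSubfield E)))
      (h : IsNonSplit (maximalRealSubfield E) E v),
      (localInputAt (finrank_maximalRealSubfield_eq_two E) T h).Hyps)
    (RA RB : GlobalIndex (maximalRealSubfield E) → RealData)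
    (h35A : ∀ τ : {τ : InfinitePlace (maximalRealSubfield E) // τ.IsReal},
      BFGYYZ2025_Thm3_5 (RA (Sum.inr τ)).toLocal)
    (h35B : ∀ τ : {τ : InfinitePlace (maximalRealSubfield E) // τ.IsReal},
      BFGYYZ2025_Thm3_5 (RB (Sum.inr τ)).toLocal)
    (hFA : ∀ τ : {τ : InfinitePlace (maximalRealSubfield E) // τ.IsReal}, (RA (Sum.inr τ)).FockDictCO)
    (hFB : ∀ τ : {τ : InfinitePlace (maximalRealSubfield E) // τ.IsReal}, (RB (Sum.inr τ)).FockDictCO)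
    (hHA : ∀ τ : {τ : InfinitePlace (maximalRealSubfield E) // τ.IsReal}, ∀ i, (RA (Sum.inr τ)).HalfLine i)
    (hHB : ∀ τ : {τ : InfinitePlace (maximalRealSubfield E) // τ.IsReal}, ∀ i, (RB (Sum.inr τ)).HalfLine i) :
    ∃ S : SignModel (GlobalIndex (maximalRealSubfield E)),
      S.kind = kindOf (maximalRealSubfield E) E ∧ S.D = (PlaceFamily.ofCM E T).D ∧ S.Solves ∧ S.RealCondB :=
  exists_signModel_ofGlobal_CO (finrank_maximalRealSubfield_eq_two E) T hT RA RB h35A h35B hFA hFB hHA hHB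

/-- THE HOST-SHAPED STATEMENT OF ROWS 183–184 ON A CM FIELD WITH THE REAL-PLACE HYPOTHESES FROM THE DISPLAYS BY
NAME (`exists_signModel_ofCM` through `exists_signModel_ofGlobal_displays`): three data at every non-split finite
place of `E⁺` with the per-place hypotheses of the statements of record v2, a real-place bundle over the places of
`E⁺` (data + declared EX facts), and at every real place of both sides the three displays — IR 0 at the real
places; KK07 Theorem 5.4(i) print pending W-11. -/
theorem exists_signModel_ofCM_displays (T : ThreeDataFamily (maximalRealSubfield E) E)
    (hT : ∀ (v : HeightOneSpectrum (RingOfIntegers (maximalRealSubfield E)))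
      (h : IsNonSplit (maximalRealSubfield E) E v),
      (localInputAt (finrank_maximalRealSubfield_eq_two E) T h).Hyps)
    (RP : RealPlaceBundle (GlobalIndex (maximalRealSubfield E)))
    (h35A : ∀ τ : {τ : InfinitePlace (maximalRealSubfield E) // τ.IsReal},
      BFGYYZ2025_Thm3_5_smooth (RP.RA (Sum.inr τ)).toLocal (fun _ => True))
    (h35B : ∀ τ : {τ : InfinitePlace (maximalRealSubfield E) // τ.IsReal},
      BFGYYZ2025_Thm3_5_smooth (RP.RB (Sum.inr τ)).toLocal (fun _ => True))
    (h54A : ∀ τ : {τ : InfinitePlace (maximalRealSubfield E) // τ.IsReal},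
      KonnoKonno2007_Thm5_4_i_lines (RP.CA (Sum.inr τ)))
    (h54B : ∀ τ : {τ : InfinitePlace (maximalRealSubfield E) // τ.IsReal},
      KonnoKonno2007_Thm5_4_i_lines (RP.CB (Sum.inr τ)))
    (h51A : ∀ τ : {τ : InfinitePlace (maximalRealSubfield E) // τ.IsReal},
      KonnoKonno2007_Fact5_1_compact (RP.CA (Sum.inr τ)))
    (h51B : ∀ τ : {τ : InfinitePlace (maximalRealSubfield E) // τ.IsReal},
      KonnoKonno2007_Fact5_1_compact (RP.CB (Sum.inr τ))) :
    ∃ S : SignModel (GlobalIndex (maximalRealSubfield E)),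
      S.kind = kindOf (maximalRealSubfield E) E ∧ S.D = (PlaceFamily.ofCM E T).D ∧ S.Solves ∧ S.RealCondB :=
  exists_signModel_ofGlobal_displays (finrank_maximalRealSubfield_eq_two E) T hT RP h35A h35B h54A h54B h51A h51B

end CM

end

end Summit.Ventures.HodgeRepro2.T6.N5LocalSignModelCM

namespace Summit.Ventures.HodgeRepro2.T6.N5LocalSignModelCMWitness

open Summit.Ventures.HodgeRepro2 IsDedekindDomain HeightOneSpectrum NumberField
  Summit.Ventures.HodgeRepro2.T6.N5Rich Summit.Ventures.HodgeRepro2.T6.N5RealPlace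
  Summit.Ventures.HodgeRepro2.T6.N5LocalSignModel Summit.Ventures.HodgeRepro2.T6.N5LocalSignModelGlobal
  Summit.Ventures.HodgeRepro2.T6.N5LocalSignModelGlobalWitness Summit.Ventures.HodgeRepro2.T6.N5LocalSignModelCM
  Summit.Ventures.HodgeRepro2.T6.N5Fock

noncomputable section

/-! ### Non-vacuity on ANY CM field (README §10.5(ii)(c)/(d)) -/

section AnyCM

variable (E : Type) [Field E] [NumberField E] [IsCMField E]

/-- The CM witness through the conjugate-orthogonal seam: t6-p8's toy family and this lane's toy real data
(`Toy.toy_fockDict.toCO`). -/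
theorem cm_global_witness_CO :
    ∃ S : SignModel (GlobalIndex (maximalRealSubfield E)), S.kind = kindOf (maximalRealSubfield E) E ∧
      S.D = (PlaceFamily.ofCM E (toyFamilyCM E)).D ∧ S.Solves ∧ S.RealCondB :=
  exists_signModel_ofCM_CO E (toyFamilyCM E) (toyFamilyCM_hyps E) (fun _ => Toy.toy) (fun _ => Toy.toy)
    (fun _ => Toy.toy_thm3_5) (fun _ => Toy.toy_thm3_5) (fun _ => Toy.toy_fockDict.toCO)
    (fun _ => Toy.toy_fockDict.toCO) (fun _ => Toy.toy_halfLine) (fun _ => Toy.toy_halfLine)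

/-- The CM witness through the displays: t6-p8's toy family, this lane's toy bundle (`toyReal₁` and the half-line
carrier on both sides at every place) and the three displays on it — every hypothesis of
`exists_signModel_ofCM_displays` discharged on any CM field. -/
theorem cm_global_witness_displays :
    ∃ S : SignModel (GlobalIndex (maximalRealSubfield E)), S.kind = kindOf (maximalRealSubfield E) E ∧
      S.D = (PlaceFamily.ofCM E (toyFamilyCM E)).D ∧ S.Solves ∧ S.RealCondB :=
  exists_signModel_ofCM_displays E (toyFamilyCM E) (toyFamilyCM_hyps E) (N5Fock.Toy.bundle _)
    (fun _ => N5Fock.Toy.toyReal₁_thm3_5_smooth) (fun _ => N5Fock.Toy.toyReal₁_thm3_5_smooth)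
    (fun _ => N5Fock.Toy.carrier_kTypeHalfLine) (fun _ => N5Fock.Toy.carrier_kTypeHalfLine)
    (fun _ => N5Fock.Toy.carrier_howeCompact) (fun _ => N5Fock.Toy.carrier_howeCompact)

end AnyCM

section Gaussian

open T5GaussianField

/-- The displays witness at the concrete CM field `ℚ(ζ₄)` (t6-p8's `isCMField_L`). -/
theorem gaussian_cm_witness_displays :
    letI := isCMField_L
    ∃ S : SignModel (GlobalIndex (maximalRealSubfield L)), S.kind = kindOf (maximalRealSubfield L) L ∧
      S.D = (PlaceFamily.ofCM L (toyFamilyCM L)).D ∧ S.Solves ∧ S.RealCondB :=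
  letI := isCMField_L
  cm_global_witness_displays L

end Gaussian

end

end Summit.Ventures.HodgeRepro2.T6.N5LocalSignModelCMWitness
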